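import Summits.QuantumFields.QCD.Theorems.SpectralDefectExtinctionWegnerEstimateSketchDefs
import Summits.QuantumFields.QCD.Theorems.SpectralDefectExtinctionWegnerEstimateStubPortContinuous

/-!
# Stub `envContinuous` of line `Sketch` (skeleton "ResolventCell", gen 4) for crux
`SpectralDefectExtinction.WegnerEstimate` (item stmt-QuantumFields-8966)

The McShane/Lipschitz envelope `badEnv R R' w = inf_{w'} [badStar R R' w' + linkCost R w w']` of the landed
`…SketchDefs` (gen 4) is CONTINUOUS in the product topology of `LinkData = (ℤ⁴ × Fin 4 → SU3)` and non-negative —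
the regularity half of the witness `bad := badEnv R R'` of `stub_currentRigidity` (the interior-normalised
min-functional `badStar` itself is only upper semicontinuous a priori).  Three steps:
* `linkCost R` (the entrywise `ℓ¹` distance of the links based in `box 4 (R+1)`) is symmetric and satisfies the
  triangle inequality (`envContinuous_linkCost_comm`, `envContinuous_linkCost_triangle`);
* hence the envelope is `1`-Lipschitz for it: `|badEnv w − badEnv u| ≤ linkCost R w u`
  (`envContinuous_abs_badEnv_sub_le`, from `le_csInf`/`csInf_le`);
* `u ↦ linkCost R w u` is continuous (finitely many continuous link entries) and vanishes at `u = w`, so the envelope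
  is continuous (`continuous_badEnv`).  Non-negativity is the landed `badEnv_nonneg`.
Also recorded for the small-ball bookkeeping downstream: `{badEnv < δ}` lies in the `δ`-tube of `{badStar < δ}`
(`envContinuous_exists_of_badEnv_lt`).  Written by the line lead (prover-line-stmt-QuantumFields-8966-c4-0).
-/

noncomputable section

namespace Summit.QuantumFields.QCD.Cruxes.WegnerEstimate.ResolventCell

open scoped Matrix BigOperators Topology
open Filter
open Literature.MathematicalPhysics.QuantumLattice Literature.MathematicalPhysics.QuantumFieldTheory
  Literature.Probability.LatticeModels
open Matrix

/-! ### The link cost is a pseudometric -/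

/-- Symmetry of the link cost. -/
theorem envContinuous_linkCost_comm (R : ℕ) (w w' : LinkData) : linkCost R w w' = linkCost R w' w := by
  simp only [linkCost, norm_sub_rev]

/-- Triangle inequality for the link cost. -/
theorem envContinuous_linkCost_triangle (R : ℕ) (w u w' : LinkData) :
    linkCost R w w' ≤ linkCost R w u + linkCost R u w' := by
  simp only [linkCost, ← Finset.sum_add_distrib]
  refine Finset.sum_le_sum fun y _ => Finset.sum_le_sum fun μ _ => Finset.sum_le_sum fun a _ =>
    Finset.sum_le_sum fun b _ => ?_
  exact norm_sub_le_norm_sub_add_norm_sub _ _ _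

/-! ### The envelope is `1`-Lipschitz for the link cost -/

/-- The set under the infimum defining `badEnv R R' u` is nonempty (`w' = u`) … -/
theorem envContinuous_set_nonempty (R R' : ℕ) (u : LinkData) :
    ({r : ℝ | ∃ w' : LinkData, r = badStar R R' w' + linkCost R u w'}).Nonempty :=
  ⟨_, u, rfl⟩

/-- … and bounded below by `0`. -/
theorem envContinuous_set_bddBelow (R R' : ℕ) (u : LinkData) :
    BddBelow {r : ℝ | ∃ w' : LinkData, r = badStar R R' w' + linkCost R u w'} := by
  refine ⟨0, ?_⟩
  rintro r ⟨w', rfl⟩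
  exact add_nonneg (badStar_nonneg R R' w') (linkCost_nonneg R u w')

/-- **One-sided Lipschitz estimate**: `badEnv w ≤ badEnv u + linkCost R w u`. -/
theorem envContinuous_badEnv_le_add (R R' : ℕ) (w u : LinkData) :
    badEnv R R' w ≤ badEnv R R' u + linkCost R w u := by
  rw [← sub_le_iff_le_add, badEnv, badEnv]
  refine le_csInf (envContinuous_set_nonempty R R' u) ?_
  rintro r ⟨w', rfl⟩
  have h1 : sInf {r : ℝ | ∃ w' : LinkData, r = badStar R R' w' + linkCost R w w'} ≤
      badStar R R' w' + linkCost R w w' :=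
    csInf_le (envContinuous_set_bddBelow R R' w) ⟨w', rfl⟩
  have h2 := envContinuous_linkCost_triangle R w u w'
  linarith

/-- **The envelope is `1`-Lipschitz for the link cost**: `|badEnv w − badEnv u| ≤ linkCost R w u`. -/
theorem envContinuous_abs_badEnv_sub_le (R R' : ℕ) (w u : LinkData) :
    |badEnv R R' w - badEnv R R' u| ≤ linkCost R w u := by
  rw [abs_sub_le_iff]
  constructor
  · linarith [envContinuous_badEnv_le_add R R' w u]
  · linarith [envContinuous_badEnv_le_add R R' u w, envContinuous_linkCost_comm R u w]

/-! ### Continuity -/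

/-- `u ↦ linkCost R w u` is continuous in the product topology (finitely many continuous link entries). -/
theorem envContinuous_continuous_linkCost_right (R : ℕ) (w : LinkData) : Continuous fun u => linkCost R w u := by
  unfold linkCost
  refine continuous_finsetSum _ fun y _ => continuous_finsetSum _ fun μ _ => continuous_finsetSum _ fun a _ =>
    continuous_finsetSum _ fun b _ => ?_
  exact (continuous_const.sub (continuous_suEntry (continuous_apply (y, μ)) a b)).norm

/-- **The envelope is continuous** (product topology on `LinkData`). -/
theorem continuous_badEnv (R R' : ℕ) : Continuous (badEnv R R') := by
  refine continuous_iff_continuousAt.2 fun w => ?_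
  rw [ContinuousAt, Metric.tendsto_nhds]
  intro ε hε
  have hc : Tendsto (fun u => linkCost R w u) (𝓝 w) (𝓝 0) := by
    have h := (envContinuous_continuous_linkCost_right R w).continuousAt (x := w)
    rwa [ContinuousAt, linkCost_self] at h
  have hev : ∀ᶠ u in 𝓝 w, linkCost R w u < ε := by
    have := (tendsto_order.1 hc).2 ε hε
    exact this
  filter_upwards [hev] with u hu
  rw [Real.dist_eq]
  calc |badEnv R R' u - badEnv R R' w| ≤ linkCost R u w := envContinuous_abs_badEnv_sub_le R R' u w
    _ = linkCost R w u := envContinuous_linkCost_comm R u w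
    _ < ε := hu

/-- **Tube inclusion** for the small-ball bookkeeping: if `badEnv w < δ` then some datum `w'` within link cost
`< δ` of `w` has `badStar w' < δ` (indeed `badStar w' + linkCost R w w' < δ`). -/
theorem envContinuous_exists_of_badEnv_lt {R R' : ℕ} {w : LinkData} {δ : ℝ} (h : badEnv R R' w < δ) :
    ∃ w' : LinkData, badStar R R' w' + linkCost R w w' < δ := by
  obtain ⟨r, ⟨w', rfl⟩, hr⟩ := exists_lt_of_csInf_lt (envContinuous_set_nonempty R R' w) h
  exact ⟨w', hr⟩

/-- **Sublevel sets of the envelope lie in the `δ`-tubes of those of `badStar`**: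
`{badEnv < δ} ⊆ {w | ∃ w', badStar w' < δ ∧ linkCost R w w' < δ}` — so a saturated Haar small-ball estimate for the
link-cost tubes of the sublevel sets of `badStar` implies the one for `badEnv` (the bet `stub_envSmallBall` may be
attacked on `badStar` directly). -/
theorem envContinuous_sublevel_subset_tube (R R' : ℕ) (δ : ℝ) :
    {w : LinkData | badEnv R R' w < δ} ⊆
      {w : LinkData | ∃ w' : LinkData, badStar R R' w' < δ ∧ linkCost R w w' < δ} := by
  intro w hw
  obtain ⟨w', hw'⟩ := envContinuous_exists_of_badEnv_lt (R := R) (R' := R') hw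
  refine ⟨w', ?_, ?_⟩
  · linarith [linkCost_nonneg R w w']
  · linarith [badStar_nonneg R R' w']

/-! ### The stub -/

/-- **Stub `envContinuous`** (gen 4), verbatim the registered statement: the envelope `badEnv R R'` is
continuous and non-negative, for all radii. -/
theorem stub_envContinuous : ∀ R R' : ℕ, Continuous (badEnv R R') ∧ ∀ w, 0 ≤ badEnv R R' w :=
  fun R R' => ⟨continuous_badEnv R R', badEnv_nonneg R R'⟩

end Summit.QuantumFields.QCD.Cruxes.WegnerEstimate.ResolventCell

end
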